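import Literature.Claims.NS.ClayVariants
import Literature.Analysis.FluidPDE.BoundedLerayHopfClay
import Literature.Analysis.FluidPDE.LeraySuitableWeakSolutions
import Literature.Analysis.FluidPDE.ClayClassLerayHopfUniqueness
import Literature.Analysis.FluidPDE.KatoMaximalTimeSingular
import HarnessLib

/-!
# Clay (A) reference — (A) ⇔ the suitable Leray–Hopf solutions from Clay data have no singular point

Companion to `ClayR3L3Bridge.lean` (ESS), `ClayR3BKMBridge.lean` (BKM), `ClayR3SerrinBridge.lean` (LPS),
`ClayR3LerayHopfBridge.lean` (a.e.-classical Leray–Hopf door) and `ClayR3LocalEnergyBridge.lean` (keeper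
`ns-claims-lit-4`; theorems only: no definition, no named fact, no `sorry`). This is the door for manuscripts
of the **partial-regularity programme** (Caffarelli–Kohn–Nirenberg 1982; Lin 1998; the ε-regularity /
monotonicity-formula register): their printed conclusion is «every suitable weak solution is regular (at every
point / on `ℝ³ × (0,T]`)», a statement about the CKN class, while Fefferman's (A) asks for a smooth solution
FROM THE DATUM with bounded energy. The two are linked by two classical facts which are THEOREMS OF THE TREE:

* **Leray's weak solutions are suitable** (CKN 1982, Appendix; Seregin 2014, App. B Def. B.1): for `ν > 0`
  and every weakly divergence-free `u₀ ∈ L²(ℝ³)` there is a global Leray–Hopf weak solution which, with its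
  Riesz-transform pressure, is a local energy solution — in particular CKN-suitable — on every strip
  `(0,T) × ℝ³` (`Literature.Analysis.FluidPDE.exists_isGlobalLerayHopf_and_isLocalEnergySolutionOn`,
  `LeraySuitableWeakSolutions.lean`); a Clay datum (4) is such a `u₀`
  (`exists_suitable_globalLerayHopf_of_clayDatum` below, with the CKN fields spelled out in
  `exists_suitable_globalLerayHopf_of_clayDatum'`);
* **locally bounded global Leray–Hopf solutions from Clay data are Clay solutions** (Kato maximal-time
  dichotomy + Clay-class weak–strong uniqueness; `clay_solution_of_locallyBounded_globalLerayHopf`,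
  `BoundedLerayHopfClay.lean`), and conversely the Clay solution is unique in the Leray–Hopf class
  (`IsNavierStokesSolution.ae_eq_of_isLerayHopfOn`, Tao 2013 Lemma 8.1 / Cor. 11.1).

Hence the doors of this file:

* `clayR3_regularityAt_of_suitableLerayHopf_regular` — **(⇐)** if every global Leray–Hopf weak solution
  from a Clay datum that is a local energy solution on every strip has only REGULAR points at positive times
  (`IsRegularPoint`: essentially bounded on a centred parabolic cylinder, CKN §6), then `clayR3.RegularityAt ν`;
* `isRegularPoint_of_clayR3_regularityAt` — **(⇒)** under (A) at `ν`, EVERY global Leray–Hopf weak solution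
  from a Clay datum (suitable or not) is regular at every point `(t, x)`, `t > 0` (it agrees a.e. on every
  strip with the smooth Clay solution, which is bounded on compact sets);
* `clayR3_regularityAt_iff_suitableLerayHopf_regular`, `clayR3_regularity_iff_suitableLerayHopf_regular` —
  the equivalence at one / every viscosity.

Typists (D-0090 claims cell): a claim «for every suitable weak solution of NS on `ℝ³ × (0,T)` … every point is
regular» typed over the tree's `IsLocalEnergySolutionOn` / `IsSuitableWeakSolutionOn` class on strips gives
`clayR3.RegularityAt ν` through `clayR3_regularityAt_of_suitableLerayHopf_regular` with NO bridge hypothesis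
(precedent: `Literature.Claims.NS.Taghizadeh2026.clayBridge_holds` / `clayA_of_corollary`, C166).

## References
* L. Caffarelli, R. Kohn, L. Nirenberg, Comm. Pure Appl. Math. 35 (1982) 771–831, §2 (2.1)–(2.5), §6
  Theorem B (regular points), Appendix (Leray's solutions are suitable). [CaffarelliKohnNirenberg1982]
* J. Leray, Acta Math. 63 (1934), Ch. V §31 p. 241 (existence), §33. [Leray1934]
* G. Seregin, *Lecture Notes on Regularity Theory for the Navier–Stokes Equations* (2014), App. B Def. B.1.
  [Seregin2014]
* T. Tao, Anal. PDE 6 (2013) = arXiv:1108.1165, Lemma 8.1, Cor. 11.1. [Tao2011]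
* P. G. Lemarié-Rieusset, *The Navier–Stokes Problem in the 21st Century* (2016), Thm 15.1 (C), Prop 12.3.
  [LemarieRieusset2016]
* C. L. Fefferman, CMI problem description (2006), (A) with (4) (6) (7) p. 2. [FeffermanClay2006]

WHAT THIS IS NOT: not a claim about NS regularity or blow-up; not a claim about any author beyond the
typed locator.
-/

noncomputable section

open scoped ContDiff ENNReal NNReal Topology

namespace Literature.Claims.NS.ClayVariants

open Set Filter MeasureTheory Function Metric Literature.Analysis Literature.Analysis.FluidPDE

variable {ν : ℝ} {u₀ : EuclideanSpace ℝ (Fin 3) → EuclideanSpace ℝ (Fin 3)}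

/-! ## Existence: a Clay datum launches a CKN-suitable global Leray–Hopf weak solution -/

/-- **A Clay datum launches a global Leray–Hopf weak solution that is a local energy solution on every
strip** (Leray 1934 existence + «Leray's weak solutions are suitable», CKN 1982 Appendix — the tree's
`exists_isGlobalLerayHopf_and_isLocalEnergySolutionOn`; a datum of class (4) is in `L²` by
`HasRapidSpatialDecay.lintegral_enorm_iteratedFDeriv_sq_lt_top` and weakly divergence free by
`VectorCalculus.IsDivFree.isWeaklyDivFree_holds`). [cite: CaffarelliKohnNirenberg1982, Appendix]
[cite: Leray1934, Ch. V §31, p. 241] [cite: Seregin2014, App. B Def. B.1] -/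
theorem exists_suitable_globalLerayHopf_of_clayDatum (hν : 0 < ν) (hu₀ : ContDiff ℝ ∞ u₀)
    (hdiv : NSWave0.IsDivFree u₀) (hdec : HasRapidSpatialDecay u₀) :
    ∃ (v : ℝ → EuclideanSpace ℝ (Fin 3) → EuclideanSpace ℝ (Fin 3))
      (p : ℝ → EuclideanSpace ℝ (Fin 3) → ℝ),
      IsGlobalLerayHopf ν 0 u₀ v ∧ ∀ T : ℝ, 0 < T → IsLocalEnergySolutionOn T ν u₀ v p := by
  have hL2 : ∫⁻ x, ‖u₀ x‖ₑ ^ 2 < ⊤ := by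
    refine lt_of_le_of_lt (le_of_eq (lintegral_congr fun x => ?_))
      (hdec.lintegral_enorm_iteratedFDeriv_sq_lt_top 0)
    rw [← ofReal_norm, ← ofReal_norm, norm_iteratedFDeriv_zero]
  have hu2 : MemLp u₀ 2 volume :=
    ⟨hu₀.continuous.aestronglyMeasurable, eLpNorm_two_lt_top_of_lintegral_enorm_sq_lt_top hL2⟩
  have hwdiv : IsWeaklyDivFree u₀ :=
    VectorCalculus.IsDivFree.isWeaklyDivFree_holds (fun x => hdiv x) (hu₀.of_le (mod_cast le_top))
  obtain ⟨v, p, hLH, -, -, -, -, -, hLE⟩ := exists_isGlobalLerayHopf_and_isLocalEnergySolutionOn hν hu2 hwdiv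
  exact ⟨v, p, hLH, hLE⟩

/-- **The same, with the CKN fields spelled out** (the shape in which manuscripts state their class, CKN
1982 §2 (2.1)–(2.5)): on every strip `(0,T) × ℝ³` the solution is CKN-suitable with the pressure `p`, has a
space–time weak gradient with finite dissipation `∫∫ |∇v|² < ∞` (`IsLerayHopfOn.exists_hasWeakSpatialGradientOn`),
and `v ∈ L^∞(0,T; L²)` (`IsLerayHopfOn.energy_bound`; `eEnergy w = ∫⁻ ‖w‖ₑ²`).
[cite: CaffarelliKohnNirenberg1982, §2 (2.1)–(2.5) and Appendix] [cite: Leray1934, Ch. V §31, p. 241] -/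
theorem exists_suitable_globalLerayHopf_of_clayDatum' (hν : 0 < ν) (hu₀ : ContDiff ℝ ∞ u₀)
    (hdiv : NSWave0.IsDivFree u₀) (hdec : HasRapidSpatialDecay u₀) :
    ∃ (v : ℝ → EuclideanSpace ℝ (Fin 3) → EuclideanSpace ℝ (Fin 3))
      (p : ℝ → EuclideanSpace ℝ (Fin 3) → ℝ),
      IsGlobalLerayHopf ν 0 u₀ v ∧ ∀ T : ℝ, 0 < T →
        IsSuitableWeakSolutionOn (slab (EuclideanSpace ℝ (Fin 3)) (Ioo 0 T) isOpen_Ioo) ν 0 v p ∧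
        (∃ G : ℝ → EuclideanSpace ℝ (Fin 3) → EuclideanSpace ℝ (Fin 3) →L[ℝ] EuclideanSpace ℝ (Fin 3),
          HasWeakSpatialGradientOn (slab (EuclideanSpace ℝ (Fin 3)) (Ioo 0 T) isOpen_Ioo) v G ∧
          ∫⁻ z in Ioo 0 T ×ˢ (univ : Set (EuclideanSpace ℝ (Fin 3))),
            ENNReal.ofReal (frobeniusNormSq (G z.1 z.2)) < ⊤) ∧
        ∃ C : ℝ≥0, ∀ᵐ t ∂(volume.restrict (Ioo 0 T)), ∫⁻ x, ‖v t x‖ₑ ^ 2 ≤ C := by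
  obtain ⟨v, p, hLH, hLE⟩ := exists_suitable_globalLerayHopf_of_clayDatum hν hu₀ hdiv hdec
  refine ⟨v, p, hLH, fun T hT => ⟨(hLE T hT).suitable, ?_, ?_⟩⟩
  · obtain ⟨G, hG, -, hGint, -⟩ := (hLH T hT).exists_hasWeakSpatialGradientOn
    exact ⟨G, hG, hGint⟩
  · obtain ⟨C, hC⟩ := (hLH T hT).energy_bound
    exact ⟨C, hC⟩

/-! ## (A) ⇐ no singular points of the suitable Leray–Hopf solutions from Clay data -/

/-- **(A) at viscosity `ν` FROM «every suitable Leray–Hopf weak solution from a Clay datum is regular at every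
point of positive time»**: the suitable Leray–Hopf solution of `exists_suitable_globalLerayHopf_of_clayDatum` is,
by hypothesis, essentially bounded on a centred parabolic cylinder about every `(T, x)`, `T > 0`, hence on
the backward cylinder `Q_r(T, x)` (`parabolicCylinder_subset_centered`), and
`clay_solution_of_locallyBounded_globalLerayHopf` supplies the Clay solution (smooth on `[0,∞) × ℝ³`,
(1)–(3), (7)). [cite: FeffermanClay2006, (A) with (4) (6) (7) p. 2] [cite: CaffarelliKohnNirenberg1982, §6 Theorem B]
[cite: LemarieRieusset2016, Thm. 15.1 (C) and Prop. 12.3] -/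
theorem clayR3_regularityAt_of_suitableLerayHopf_regular (hν : 0 < ν)
    (h : ∀ u₀ : EuclideanSpace ℝ (Fin 3) → EuclideanSpace ℝ (Fin 3), ContDiff ℝ ∞ u₀ →
      NSWave0.IsDivFree u₀ → HasRapidSpatialDecay u₀ →
      ∀ (v : ℝ → EuclideanSpace ℝ (Fin 3) → EuclideanSpace ℝ (Fin 3))
        (p : ℝ → EuclideanSpace ℝ (Fin 3) → ℝ),
        IsGlobalLerayHopf ν 0 u₀ v → (∀ T : ℝ, 0 < T → IsLocalEnergySolutionOn T ν u₀ v p) →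
          ∀ z : ℝ × EuclideanSpace ℝ (Fin 3), 0 < z.1 → IsRegularPoint v z) :
    clayR3.RegularityAt ν := by
  intro u₀ hu₀ hdiv hdec
  obtain ⟨v, p, hv, hLE⟩ := exists_suitable_globalLerayHopf_of_clayDatum hν hu₀ hdiv hdec
  have hbd : ∀ T : ℝ, 0 < T → ∀ x : EuclideanSpace ℝ (Fin 3), ∃ r : ℝ, 0 < r ∧
      eLpNorm (uncurry v) ⊤ (volume.restrict (parabolicCylinder r ((T : ℝ), x))) < ⊤ := by
    intro T hT x
    obtain ⟨r, hr, hreg⟩ := h u₀ hu₀ hdiv hdec v p hv hLE (T, x) hT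
    exact ⟨r, hr, lt_of_le_of_lt (eLpNorm_mono_measure _
      (Measure.restrict_mono (parabolicCylinder_subset_centered r _) le_rfl)) hreg⟩
  obtain ⟨U, P, hU, hP, hns, hE⟩ := clay_solution_of_locallyBounded_globalLerayHopf hν hu₀ hdiv hdec hv hbd
  exact ⟨U, P, hU, hP, hns, hE⟩

/-! ## (A) ⇒ no singular points of ANY global Leray–Hopf solution from Clay data -/

/-- **Under (A) at `ν`, every global Leray–Hopf weak solution from a Clay datum is regular at every point
`(t, x)` with `t > 0`** (suitable or not): by Clay-class weak–strong uniqueness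
(`IsNavierStokesSolution.ae_eq_of_isLerayHopfOn`) it agrees slice-wise a.e., hence a.e. in space–time on the
strip `(0, t+1) × ℝ³` (`ae_restrict_prod_of_forall_ae_eq`), with the smooth Clay solution, which is bounded
on the compact closure `[t − r², t + r²] × B̄_r(x)` of a centred cylinder with `r² < t`, `r ≤ 1`.
[cite: CaffarelliKohnNirenberg1982, §6 Theorem B] [cite: Tao2011, Lemma 8.1 and Cor. 11.1]
[cite: FeffermanClay2006, (A) with (4) (6) (7) p. 2] -/
theorem isRegularPoint_of_clayR3_regularityAt (hν : 0 < ν) (hreg : clayR3.RegularityAt ν)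
    (hu₀ : ContDiff ℝ ∞ u₀) (hdiv : NSWave0.IsDivFree u₀) (hdec : HasRapidSpatialDecay u₀)
    {v : ℝ → EuclideanSpace ℝ (Fin 3) → EuclideanSpace ℝ (Fin 3)} (hv : IsGlobalLerayHopf ν 0 u₀ v)
    (z : ℝ × EuclideanSpace ℝ (Fin 3)) (hz : 0 < z.1) : IsRegularPoint v z := by
  obtain ⟨t₀, x₀⟩ := z
  simp only at hz
  obtain ⟨U, P, hU, hP, hns, hE⟩ := hreg u₀ hu₀ hdiv hdec
  -- the strip `(0, T) × ℝ³`, `T = t₀ + 1`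
  set T : ℝ := t₀ + 1 with hT_def
  have hT : 0 < T := by positivity
  -- slice-wise a.e. equality with the Clay solution, then space–time a.e. equality on the strip
  have hslice : ∀ t ∈ Ioo 0 T, v t =ᵐ[volume] U t := fun t ht =>
    IsNavierStokesSolution.ae_eq_of_isLerayHopfOn hν hT hdec hns hU hP hE (hv T hT) t ⟨ht.1, ht.2.le⟩
  have hUc : ContinuousOn (uncurry U) (Ici 0 ×ˢ (univ : Set (EuclideanSpace ℝ (Fin 3)))) := hU.continuousOn
  have hstrip : Ioo 0 T ×ˢ (univ : Set (EuclideanSpace ℝ (Fin 3))) ⊆ Ici 0 ×ˢ univ :=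
    prod_mono (fun t ht => le_of_lt ht.1) Subset.rfl
  have hUmeas : AEStronglyMeasurable (uncurry U)
      (volume.restrict (Ioo 0 T ×ˢ (univ : Set (EuclideanSpace ℝ (Fin 3))))) :=
    (hUc.mono hstrip).aestronglyMeasurable (measurableSet_Ioo.prod MeasurableSet.univ)
  have hae : uncurry v =ᵐ[volume.restrict (Ioo 0 T ×ˢ (univ : Set (EuclideanSpace ℝ (Fin 3))))]
      uncurry U :=
    ae_restrict_prod_of_forall_ae_eq hslice (hv T hT).weak.1 hUmeas
  -- a radius with `r² < t₀` and `r ≤ 1`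
  obtain ⟨r, hr, hrt, hr1⟩ : ∃ r : ℝ, 0 < r ∧ r ^ 2 < t₀ ∧ r ^ 2 ≤ 1 := by
    refine ⟨min 1 (t₀ / 2), by positivity, ?_, ?_⟩
    · have h1 : min 1 (t₀ / 2) ≤ 1 := min_le_left _ _
      have h2 : min 1 (t₀ / 2) ≤ t₀ / 2 := min_le_right _ _
      have h3 : 0 < min 1 (t₀ / 2) := by positivity
      nlinarith
    · have h1 : min 1 (t₀ / 2) ≤ 1 := min_le_left _ _
      have h3 : 0 < min 1 (t₀ / 2) := by positivity
      nlinarith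
  refine ⟨r, hr, ?_⟩
  -- the compact closure of the centred cylinder, inside `[0, ∞) × ℝ³` and inside the strip
  set K : Set (ℝ × EuclideanSpace ℝ (Fin 3)) := Icc (t₀ - r ^ 2) (t₀ + r ^ 2) ×ˢ closedBall x₀ r with hK
  have hKc : IsCompact K := isCompact_Icc.prod (isCompact_closedBall _ _)
  have hKsub : K ⊆ Ici 0 ×ˢ (univ : Set (EuclideanSpace ℝ (Fin 3))) := by
    rintro ⟨t, y⟩ ⟨ht, -⟩
    exact ⟨show 0 ≤ t by linarith [ht.1], mem_univ _⟩
  have hQK : parabolicCylinderCentered r ((t₀ : ℝ), x₀) ⊆ K := by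
    rintro ⟨t, y⟩ hw
    simp only [parabolicCylinderCentered, mem_prod, mem_Ioo, mem_ball] at hw
    exact ⟨⟨hw.1.1.le, hw.1.2.le⟩, mem_closedBall.2 hw.2.le⟩
  have hQstrip : parabolicCylinderCentered r ((t₀ : ℝ), x₀) ⊆
      Ioo 0 T ×ˢ (univ : Set (EuclideanSpace ℝ (Fin 3))) := by
    rintro ⟨t, y⟩ hw
    simp only [parabolicCylinderCentered, mem_prod, mem_Ioo, mem_ball] at hw
    exact ⟨⟨by linarith [hw.1.1], by linarith [hw.1.2]⟩, mem_univ _⟩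
  obtain ⟨M, hM⟩ := hKc.exists_bound_of_continuousOn (hUc.mono hKsub)
  have hQmeas : MeasurableSet (parabolicCylinderCentered r ((t₀ : ℝ), x₀)) :=
    (isOpen_parabolicCylinderCentered r _).measurableSet
  have hae' : ∀ᵐ w ∂(volume.restrict (parabolicCylinderCentered r ((t₀ : ℝ), x₀))),
      uncurry v w = uncurry U w := ae_restrict_of_ae_restrict_of_subset hQstrip hae
  have hbdd : ∀ᵐ w ∂(volume.restrict (parabolicCylinderCentered r ((t₀ : ℝ), x₀))), ‖uncurry v w‖ ≤ M := by
    filter_upwards [hae', ae_restrict_mem hQmeas] with w hw hwQ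
    rw [hw]; exact hM w (hQK hwQ)
  exact lt_of_le_of_lt (eLpNorm_le_of_ae_bound hbdd) (by simp)

/-! ## The door as an equivalence -/

/-- **(A) at one viscosity ⇔ the suitable Leray–Hopf weak solutions from Clay data have no singular point at
positive times.** For `ν > 0`: `clayR3.RegularityAt ν` iff for every Clay datum (smooth, divergence free,
class (4)) every global Leray–Hopf weak solution from it which is a local energy solution (CKN-suitable, Seregin
App. B Def. B.1) on every strip `(0,T) × ℝ³` is regular (`IsRegularPoint`, CKN §6) at every `(t, x)`, `t > 0`.
[cite: FeffermanClay2006, (A) with (4) (6) (7) p. 2] [cite: CaffarelliKohnNirenberg1982, §6 Theorem B and Appendix]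
[cite: LemarieRieusset2016, Thm. 15.1 (C) and Prop. 12.3] [cite: Tao2011, Lemma 8.1 and Cor. 11.1] -/
theorem clayR3_regularityAt_iff_suitableLerayHopf_regular (hν : 0 < ν) :
    clayR3.RegularityAt ν ↔
      ∀ u₀ : EuclideanSpace ℝ (Fin 3) → EuclideanSpace ℝ (Fin 3), ContDiff ℝ ∞ u₀ →
        NSWave0.IsDivFree u₀ → HasRapidSpatialDecay u₀ →
        ∀ (v : ℝ → EuclideanSpace ℝ (Fin 3) → EuclideanSpace ℝ (Fin 3))
          (p : ℝ → EuclideanSpace ℝ (Fin 3) → ℝ),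
          IsGlobalLerayHopf ν 0 u₀ v → (∀ T : ℝ, 0 < T → IsLocalEnergySolutionOn T ν u₀ v p) →
            ∀ z : ℝ × EuclideanSpace ℝ (Fin 3), 0 < z.1 → IsRegularPoint v z :=
  ⟨fun hreg _ hu₀ hdiv hdec _ _ hv _ z hz => isRegularPoint_of_clayR3_regularityAt hν hreg hu₀ hdiv hdec hv z hz,
    clayR3_regularityAt_of_suitableLerayHopf_regular hν⟩

/-- **(A) ⇔ no singular point of the suitable Leray–Hopf solutions from Clay data, at every viscosity.**
`clayR3.Regularity` is token-for-token the summit statement `NavierStokesRegularity`.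
[cite: FeffermanClay2006, (A) with (4) (6) (7) p. 2] [cite: CaffarelliKohnNirenberg1982, §6 Theorem B and Appendix] -/
theorem clayR3_regularity_iff_suitableLerayHopf_regular :
    clayR3.Regularity ↔
      ∀ ν : ℝ, 0 < ν →
      ∀ u₀ : EuclideanSpace ℝ (Fin 3) → EuclideanSpace ℝ (Fin 3), ContDiff ℝ ∞ u₀ →
        NSWave0.IsDivFree u₀ → HasRapidSpatialDecay u₀ →
        ∀ (v : ℝ → EuclideanSpace ℝ (Fin 3) → EuclideanSpace ℝ (Fin 3))
          (p : ℝ → EuclideanSpace ℝ (Fin 3) → ℝ),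
          IsGlobalLerayHopf ν 0 u₀ v → (∀ T : ℝ, 0 < T → IsLocalEnergySolutionOn T ν u₀ v p) →
            ∀ z : ℝ × EuclideanSpace ℝ (Fin 3), 0 < z.1 → IsRegularPoint v z :=
  forall₂_congr fun _ hν => clayR3_regularityAt_iff_suitableLerayHopf_regular hν

/-- **… and at any SINGLE viscosity** (scaling `clayR3_regularityAt_iff`). [cite: FeffermanClay2006, (A) p. 2] -/
theorem clayR3_regularity_iff_suitableLerayHopf_regular_at (hν : 0 < ν) :
    clayR3.Regularity ↔
      ∀ u₀ : EuclideanSpace ℝ (Fin 3) → EuclideanSpace ℝ (Fin 3), ContDiff ℝ ∞ u₀ →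
        NSWave0.IsDivFree u₀ → HasRapidSpatialDecay u₀ →
        ∀ (v : ℝ → EuclideanSpace ℝ (Fin 3) → EuclideanSpace ℝ (Fin 3))
          (p : ℝ → EuclideanSpace ℝ (Fin 3) → ℝ),
          IsGlobalLerayHopf ν 0 u₀ v → (∀ T : ℝ, 0 < T → IsLocalEnergySolutionOn T ν u₀ v p) →
            ∀ z : ℝ × EuclideanSpace ℝ (Fin 3), 0 < z.1 → IsRegularPoint v z := by
  rw [← clayR3_regularityAt_iff hν]
  exact clayR3_regularityAt_iff_suitableLerayHopf_regular hν

end Literature.Claims.NS.ClayVariants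

end

-- WHAT THIS IS NOT: not a claim about NS regularity or blow-up; not a claim about any author beyond the typed locator.
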